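import Summits.ResolutionOfSingularities.ResolutionOfSingularities.Theorems.PurelyInseparableDim4ResConePairVirtualChain
import Summits.ResolutionOfSingularities.ResolutionOfSingularities.Theorems.PurelyInseparableDim4ResConeDInfTT
import Summits.ResolutionOfSingularities.ResolutionOfSingularities.Theorems.PurelyInseparableDim4PairVirtualStep
import Summits.ResolutionOfSingularities.ResolutionOfSingularities.Theorems.PurelyInseparableDim4ResConeSatellitePair
import Summits.ResolutionOfSingularities.ResolutionOfSingularities.Theorems.PurelyInseparableDim4TschirnhausChain
import HarnessLib
import HarnessLib.Audit.Tags

/-!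
# Purely inseparable four-folds — EVERY `e_G = 2` TAIL WITH AT MOST TWO BOUNDARY LETTERS HAS AN HONEST PAIR-CONFINED PASSIVE-FREE
# RE-PRESENTATION, FOR EVERY PRIME `p` AND EVERY SHADE `d` (K2(p) lane, SLICE C, general-`p` reduction of the binary-cone tails to the
# two-letter game; file-holder res-dim4-p-5 g5)

[OURS · counted 0 · cell `res-dim4-pi` · K2(p) lane, slice C (general-`p` programme after K2(5), holder rulings 2026-08-29 08:19:54Z:
re-presentation technology res-dim4-typ-1 g4 `pair_virtual_step (p)` p708914, assembly + entry res-dim4-p-5 g5) · seat p-5 g5.]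
Nothing here proves K2(p) for any `p`, `NoIsolatedTrap p p` or resolution of singularities in dimension ≥ 4 / characteristic `p` —
NOT proved; this is a REDUCTION (an honest re-presentation exists), not a kill.  AI kernel work, weaker than expert review.

THE REDUCTION.  A witnessed isolated above-floor `Step0 p` chain with `x^{r₀} ∣ F₀`, constant shade `d` and `e_G ≡ 2` from `k₀`,
whose boundary has AT MOST TWO LETTERS at every `k ≥ k₀` (`∃ x y, ∀ i ∉ {x, y}, r_k i = 0`), admits an HONEST virtual partner whose
chart letters lie in ONE FIXED PAIR `{a, a′}` and whose other two letters are never boundary letters — same shade, `e_G ≡ 2`,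
isolated, above the floor, weights = the real weights renamed (`(c′ t).r = (c (kₑ + t)).r ∘ π_t`).  So for every `(p, d)` the
binary-cone tails with ≤ 2 boundary letters reduce to the TWO-LETTER GAME (at `(5,4)`: res-dim4-p-5 g4's `no_pair_tail_four_five`;
at `p ≥ 7` open).  Tails with three boundary letters recurring (the `(2,2,1)`-type ledger classes at `p ≥ 7`, res-dim4-p-5 g5's
datum 08:21Z) are NOT covered.
* `pair_entry_of_support_le_two (p)` — after ANY satellite step `k ≥ k₀` (FT `exists_satellite_ge`): `c (k+2)` has boundary
  EXACTLY `{j k, j (k+1)}` (newborn weights `o − p ≥ 1`, the satellite keeps `j k`; at most two letters) and is TT for that pair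
  (`tt_of_satellite`, p707227), clean (`FrameChange.deletePthPowers_step_F`);
* **`pair_representation_of_support_le_two (p)`** — entry → `SwapTransport.pairInv_refl p` → `pair_virtual_chain p` (p708715) fed by
  `SwapTransport.pair_virtual_step p` → the pair-confined chain, with the weight correspondence exported.
[cite: CossartJannsenSaito2020, Thm. 3.10(4), Thm. 3.14, Thm. 9.3] [cite: Hauser2010, §§F–G (chart expressions of a point blowup; cleaning)]
bears_on: LADDER-RESOLUTION:D157-DOOR2 (res-dim4-pi · K2(p) = `RidgeBudget.NoAboveFloorTrap p p` · slice C, general-`p` pair-confined reduction).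
Supports stmt-ResolutionOfSingularities-16155 (helper).
-/

set_option linter.dupNamespace false -- mandated namespace of this single-conjunct summit

noncomputable section

namespace Summit.ResolutionOfSingularities.ResolutionOfSingularities.Theorems.PIDim4

namespace ResCone

open MvPolynomial Finset
open Literature.AlgebraicGeometry.Resolution
open Literature.AlgebraicGeometry.Resolution.CentreBlowup
open Literature.AlgebraicGeometry.Resolution.Hauser2010
open Literature.AlgebraicGeometry.Resolution.HauserPerlega2019

variable {K : Type} [Field K] [DecidableEq K] (p : ℕ) [Fact p.Prime] [CharP K p]

/-- **THE PAIR ENTRY, every prime `p`, every shade**: on a constant-`(d, e_G = 2)` tail with at most two boundary letters from `k₀`,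
after a satellite step `k ≥ k₀` (which exists by FT) the state `c (k+2)` has boundary EXACTLY `{j k, j (k+1)}`, is TT for that pair,
and is clean. [OURS] [cite: CossartJannsenSaito2020, Thm. 3.10(4), Thm. 3.14, Thm. 9.3] -/
theorem pair_entry_of_support_le_two {c : ℕ → State K} {j : ℕ → Fin 4} {b : ℕ → Fin 4 → K}
    (hc : ∀ k, IsIsolated p (c k).F ∧ Step0 p (c k) (c (k + 1))) (hw : FreeTail.IsWitnessedChain p c j b)
    (hr0 : ∀ e ∈ (c 0).F.support, (c 0).r ≤ e) (hfloor : ∀ k, ordZero (c k).F ≠ p) {k₀ d : ℕ}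
    (hshade : ∀ k, k₀ ≤ k → (c k).shade = (d : ℕ∞)) (he : ∀ k, k₀ ≤ k → Module.finrank K (resVertex (c k)) = 2)
    (hsupp : ∀ k, k₀ ≤ k → ∃ x y : Fin 4, ∀ i, i ≠ x → i ≠ y → (c k).r i = 0) {N : ℕ} (hN : k₀ ≤ N) :
    ∃ k, N ≤ k ∧ j k ≠ j (k + 1) ∧ 1 ≤ (c (k + 2)).r (j k) ∧ 1 ≤ (c (k + 2)).r (j (k + 1)) ∧
      (∀ i, i ≠ j k → i ≠ j (k + 1) → (c (k + 2)).r i = 0) ∧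
      (∀ v ∈ resVertex (c (k + 2)), v (j k) = 0 → v (j (k + 1)) = 0 → v = 0) ∧
      deletePthPowers p (c (k + 2)).F = (c (k + 2)).F := by
  obtain ⟨k, hk, hsat⟩ := exists_satellite_ge p hc hw N
  have hstep : ∀ k, c (k + 1) = CentreBlowup.step p Finset.univ (j k) (b k) (c k) := fun k => (hw k).2.2.2.2
  -- newborn weights are `o − p ≥ 1`
  have hnew : ∀ m, 1 ≤ (c (m + 1)).r (j m) := by
    intro m
    obtain ⟨o, ho, hpo, -⟩ := chain_band p hc hfloor m
    rw [hstep m, step_r_univ' p (j m) (b m) (c m) ho, Finsupp.coe_update, Function.update_self]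
    omega
  have h1 : 1 ≤ (c (k + 2)).r (j (k + 1)) := hnew (k + 1)
  have h2 : 1 ≤ (c (k + 2)).r (j k) := by
    obtain ⟨o, ho, -, -⟩ := chain_band p hc hfloor (k + 1)
    have h := hnew k
    rw [hstep (k + 1), step_r_univ' p (j (k + 1)) (b (k + 1)) (c (k + 1)) ho, Finsupp.coe_update,
      Function.update_of_ne hsat.1.symm, Finsupp.filter_apply, if_pos hsat.2]
    exact h
  -- at most two boundary letters at `k + 2`, two of which are `j k ≠ j (k+1)`
  have hoth : ∀ i, i ≠ j k → i ≠ j (k + 1) → (c (k + 2)).r i = 0 := by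
    obtain ⟨x, y, hxy⟩ := hsupp (k + 2) (by omega)
    have hjk : j k = x ∨ j k = y := by
      by_contra hno; push Not at hno; have := hxy (j k) hno.1 hno.2; omega
    have hjk1 : j (k + 1) = x ∨ j (k + 1) = y := by
      by_contra hno; push Not at hno; have := hxy (j (k + 1)) hno.1 hno.2; omega
    intro i hi hi'
    have hne := hsat.1
    apply hxy
    · rcases hjk with h | h
      · rw [← h]; exact hi
      · rcases hjk1 with h' | h'
        · rw [← h']; exact hi'
        · exact absurd (h.trans h'.symm) hne.symm
    · rcases hjk with h | h
      · rcases hjk1 with h' | h'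
        · exact absurd (h.trans h'.symm) hne.symm
        · rw [← h']; exact hi'
      · rw [← h]; exact hi
  refine ⟨k, hk, hsat.1.symm, h2, h1, hoth, tt_of_satellite p hc hw hr0 hfloor hshade he (by omega) hsat, ?_⟩
  rw [hstep (k + 1)]
  exact FrameChange.deletePthPowers_step_F p Finset.univ (j (k + 1)) (b (k + 1)) (c (k + 1))

/-- **PAIR-CONFINED RE-PRESENTATION OF EVERY `e_G = 2` TAIL WITH AT MOST TWO BOUNDARY LETTERS, every prime `p`, every shade `d`.**
On a witnessed isolated above-floor `Step0 p` chain with `x^{r₀} ∣ F₀`, constant shade `d` and `e_G ≡ 2` from `k₀`, with at most two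
boundary letters at every `k ≥ k₀`: for every `N ≥ k₀` there are an entry time `kₑ ≥ N`, a pair `a ≠ a′`, and an HONEST witnessed isolated
above-floor `Step0 p` chain `c′` with `x^{r₀} ∣ F₀`, `c′ 0 = c kₑ`, constant shade `d`, `e_G ≡ 2`, chart letters in `{a, a′}`, the other two
letters never boundary, and weights `(c′ t).r = (c (kₑ + t)).r ∘ π_t` for permutations `π_t`.  (Entry `pair_entry_of_support_le_two`,
invariant res-dim4-typ-1 g4's `INV_p` through `pairInv_refl` / `pair_virtual_step`, assembly `pair_virtual_chain`.) [OURS]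
[cite: CossartJannsenSaito2020, Thm. 3.10(4), Thm. 3.14, Thm. 9.3] [cite: Hauser2010, §§F–G (chart expressions of a point blowup; cleaning)] -/
theorem pair_representation_of_support_le_two {c : ℕ → State K} {j : ℕ → Fin 4} {b : ℕ → Fin 4 → K}
    (hc : ∀ k, IsIsolated p (c k).F ∧ Step0 p (c k) (c (k + 1))) (hw : FreeTail.IsWitnessedChain p c j b)
    (hr0 : ∀ e ∈ (c 0).F.support, (c 0).r ≤ e) (hfloor : ∀ k, ordZero (c k).F ≠ p) {k₀ d : ℕ}
    (hshade : ∀ k, k₀ ≤ k → (c k).shade = (d : ℕ∞)) (he : ∀ k, k₀ ≤ k → Module.finrank K (resVertex (c k)) = 2)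
    (hsupp : ∀ k, k₀ ≤ k → ∃ x y : Fin 4, ∀ i, i ≠ x → i ≠ y → (c k).r i = 0) {N : ℕ} (hN : k₀ ≤ N) :
    ∃ (kₑ : ℕ) (a a' : Fin 4) (c' : ℕ → State K) (j' : ℕ → Fin 4) (b' : ℕ → Fin 4 → K), N ≤ kₑ ∧ a ≠ a' ∧ c' 0 = c kₑ ∧
      (∀ t, ∃ π : Equiv.Perm (Fin 4), (c' t).r = Finsupp.mapDomain (Equiv.symm π) (c (kₑ + t)).r) ∧
      (∀ t, IsIsolated p (c' t).F ∧ Step0 p (c' t) (c' (t + 1))) ∧ FreeTail.IsWitnessedChain p c' j' b' ∧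
      (∀ e ∈ (c' 0).F.support, (c' 0).r ≤ e) ∧ (∀ t, ordZero (c' t).F ≠ p) ∧
      (∀ t, 0 ≤ t → (c' t).shade = (d : ℕ∞)) ∧ (∀ t, 0 ≤ t → Module.finrank K (resVertex (c' t)) = 2) ∧
      (∀ t, 0 ≤ t → (j' t = a ∨ j' t = a')) ∧ (∀ t, 0 ≤ t → ∀ i, i ≠ a → i ≠ a' → (c' t).r i = 0) := by
  have hstep : ∀ k, c (k + 1) = CentreBlowup.step p Finset.univ (j k) (b k) (c k) := fun k => (hw k).2.2.2.2
  have hdivk : ∀ k, ∀ e ∈ (c k).F.support, (c k).r ≤ e := IsolatedBand.isolated_chain_forall_le hc hr0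
  have hord : ∀ m, k₀ ≤ m → ordZero (c m).F = (((c m).r.degree + d : ℕ) : ℕ∞) ∧ p < (c m).r.degree + d := by
    intro m hm
    obtain ⟨o, ho, hpo, -, hod⟩ := chain_shade_nat p hc hfloor hshade hm
    have hro := degree_r_le ho (hdivk m)
    refine ⟨?_, by omega⟩
    rw [ho]; congr 1; omega
  -- (1) entry
  obtain ⟨k, hk, hjj, h2, h1, hoth, hTT, hclean⟩ := pair_entry_of_support_le_two p hc hw hr0 hfloor hshade he hsupp hN
  set a : Fin 4 := j k with ha
  set a' : Fin 4 := j (k + 1) with ha'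
  have hentry := SwapTransport.pairInv_refl p hjj hclean (hdivk (k + 2)) hoth (hc (k + 2)).1 (he (k + 2) (by omega)) hTT
  -- (2) the virtual chain
  obtain ⟨c', j', b', h0, hInv, hc', hw', hr0', hfloor', hshade', he', hletters, hpass⟩ :=
    pair_virtual_chain (K := K) p (d := d) (a := a) (a' := a') (B₀ := c (k + 2))
      (Inv := fun t B => ∃ π : Equiv.Perm (Fin 4), (B.r = Finsupp.mapDomain (Equiv.symm π) (c (k + 2 + t)).r ∧
        (∀ i, i ≠ a → i ≠ a' → B.r i = 0) ∧ ordZero B.F = ordZero (c (k + 2 + t)).F ∧ B.shade = (c (k + 2 + t)).shade ∧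
        (∀ d ∈ B.F.support, B.r ≤ d) ∧ IsIsolated p B.F ∧ Module.finrank K (ResCone.resVertex B) = 2 ∧
        (∀ v ∈ ResCone.resVertex B, v a = 0 → v a' = 0 → v = 0) ∧
        ∃ (Θ e : ℕ → Fin 4 → MvPolynomial (Fin 4) K), (∀ M k, Θ (M + 1) k - Θ M k ∈ originIdeal K ^ (M + 2)) ∧
          ∀ M, (∀ k, constantCoeff (Θ M k) = 0) ∧
            (∀ i, B.r i ≠ 0 → Θ M (π i) = X i * e M i ∧ constantCoeff (e M i) ≠ 0) ∧
            IsUnit (Matrix.det (Matrix.of fun k m => coeff (Finsupp.single m 1) (Θ M k))) ∧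
            ∃ U E : MvPolynomial (Fin 4) K, constantCoeff U ≠ 0 ∧ E ∈ originIdeal K ^ M ∧
              B.F = deletePthPowers p (U ^ p * aeval (Θ M) (c (k + 2 + t)).F) + E))
      ⟨1, hentry⟩
      (fun t B hB => by
        obtain ⟨π, hr, hpairB, hoB, -, hdivB, hisoB, heB, -, -⟩ := hB
        have hkt : k₀ ≤ k + 2 + t := by omega
        obtain ⟨ho, hpo⟩ := hord (k + 2 + t) hkt
        refine ⟨hisoB, ?_, ?_, heB, hpairB, hdivB⟩
        · rw [hoB, ho, hr, Finsupp.degree_mapDomain]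
        · rw [hr, Finsupp.degree_mapDomain]; exact hpo)
      (fun t B hB => by
        obtain ⟨π, hinv⟩ := hB
        have hkt : k₀ ≤ k + 2 + t := by omega
        have hkt1 : k₀ ≤ k + 2 + t + 1 := by omega
        obtain ⟨o, ho, hpo, ho2⟩ := chain_band p hc hfloor (k + 2 + t)
        obtain ⟨o', ho', hpo', ho2'⟩ := chain_band p hc hfloor (k + 2 + t + 1)
        have hsh : (c (k + 2 + t + 1)).shade = (c (k + 2 + t)).shade := by rw [hshade _ hkt1, hshade _ hkt]
        obtain ⟨ℓ, β, π', hℓ, hβ, hinv'⟩ := SwapTransport.pair_virtual_step p hjj (c (k + 2 + t)) (c (k + 2 + t + 1)) B π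
          (j (k + 2 + t)) (b (k + 2 + t)) (hw (k + 2 + t)).2.1 (hstep (k + 2 + t)) (hdivk _) (hdivk _) ⟨o, ho, hpo, ho2⟩
          ⟨o', ho', hpo', ho2'⟩ hsh (hc (k + 2 + t + 1)).1 (he _ hkt1) hinv
        exact ⟨ℓ, β, hℓ, hβ, π', hinv'⟩)
  refine ⟨k + 2, a, a', c', j', b', by omega, hjj, h0, fun t => ?_, hc', hw', hr0', hfloor', hshade', he', hletters, hpass⟩
  obtain ⟨π, hr, -⟩ := hInv t
  exact ⟨π, hr⟩

/-- **THE SAME, WITH TT EXPORTED**: the honest pair-confined partner of `pair_representation_of_support_le_two` is moreover TT for its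
pair `{a, a′}` at EVERY time (res-dim4-typ-1 g4's invariant carries it), the datum the two-letter game reads (kernel-determined free
translations). [OURS] [cite: CossartJannsenSaito2020, Thm. 3.10(4), Thm. 3.14, Thm. 9.3] -/
theorem pair_representation_of_support_le_two' {c : ℕ → State K} {j : ℕ → Fin 4} {b : ℕ → Fin 4 → K}
    (hc : ∀ k, IsIsolated p (c k).F ∧ Step0 p (c k) (c (k + 1))) (hw : FreeTail.IsWitnessedChain p c j b)
    (hr0 : ∀ e ∈ (c 0).F.support, (c 0).r ≤ e) (hfloor : ∀ k, ordZero (c k).F ≠ p) {k₀ d : ℕ}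
    (hshade : ∀ k, k₀ ≤ k → (c k).shade = (d : ℕ∞)) (he : ∀ k, k₀ ≤ k → Module.finrank K (resVertex (c k)) = 2)
    (hsupp : ∀ k, k₀ ≤ k → ∃ x y : Fin 4, ∀ i, i ≠ x → i ≠ y → (c k).r i = 0) {N : ℕ} (hN : k₀ ≤ N) :
    ∃ (kₑ : ℕ) (a a' : Fin 4) (c' : ℕ → State K) (j' : ℕ → Fin 4) (b' : ℕ → Fin 4 → K), N ≤ kₑ ∧ a ≠ a' ∧ c' 0 = c kₑ ∧
      (∀ t, ∃ π : Equiv.Perm (Fin 4), (c' t).r = Finsupp.mapDomain (Equiv.symm π) (c (kₑ + t)).r) ∧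
      (∀ t, ∀ v ∈ resVertex (c' t), v a = 0 → v a' = 0 → v = 0) ∧
      (∀ t, IsIsolated p (c' t).F ∧ Step0 p (c' t) (c' (t + 1))) ∧ FreeTail.IsWitnessedChain p c' j' b' ∧
      (∀ e ∈ (c' 0).F.support, (c' 0).r ≤ e) ∧ (∀ t, ordZero (c' t).F ≠ p) ∧
      (∀ t, 0 ≤ t → (c' t).shade = (d : ℕ∞)) ∧ (∀ t, 0 ≤ t → Module.finrank K (resVertex (c' t)) = 2) ∧
      (∀ t, 0 ≤ t → (j' t = a ∨ j' t = a')) ∧ (∀ t, 0 ≤ t → ∀ i, i ≠ a → i ≠ a' → (c' t).r i = 0) := by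
  have hstep : ∀ k, c (k + 1) = CentreBlowup.step p Finset.univ (j k) (b k) (c k) := fun k => (hw k).2.2.2.2
  have hdivk : ∀ k, ∀ e ∈ (c k).F.support, (c k).r ≤ e := IsolatedBand.isolated_chain_forall_le hc hr0
  have hord : ∀ m, k₀ ≤ m → ordZero (c m).F = (((c m).r.degree + d : ℕ) : ℕ∞) ∧ p < (c m).r.degree + d := by
    intro m hm
    obtain ⟨o, ho, hpo, -, hod⟩ := chain_shade_nat p hc hfloor hshade hm
    have hro := degree_r_le ho (hdivk m)
    refine ⟨?_, by omega⟩
    rw [ho]; congr 1; omega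
  obtain ⟨k, hk, hjj, h2, h1, hoth, hTT, hclean⟩ := pair_entry_of_support_le_two p hc hw hr0 hfloor hshade he hsupp hN
  set a : Fin 4 := j k with ha
  set a' : Fin 4 := j (k + 1) with ha'
  have hentry := SwapTransport.pairInv_refl p hjj hclean (hdivk (k + 2)) hoth (hc (k + 2)).1 (he (k + 2) (by omega)) hTT
  obtain ⟨c', j', b', h0, hInv, hc', hw', hr0', hfloor', hshade', he', hletters, hpass⟩ :=
    pair_virtual_chain (K := K) p (d := d) (a := a) (a' := a') (B₀ := c (k + 2))
      (Inv := fun t B => ∃ π : Equiv.Perm (Fin 4), (B.r = Finsupp.mapDomain (Equiv.symm π) (c (k + 2 + t)).r ∧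
        (∀ i, i ≠ a → i ≠ a' → B.r i = 0) ∧ ordZero B.F = ordZero (c (k + 2 + t)).F ∧ B.shade = (c (k + 2 + t)).shade ∧
        (∀ d ∈ B.F.support, B.r ≤ d) ∧ IsIsolated p B.F ∧ Module.finrank K (ResCone.resVertex B) = 2 ∧
        (∀ v ∈ ResCone.resVertex B, v a = 0 → v a' = 0 → v = 0) ∧
        ∃ (Θ e : ℕ → Fin 4 → MvPolynomial (Fin 4) K), (∀ M k, Θ (M + 1) k - Θ M k ∈ originIdeal K ^ (M + 2)) ∧
          ∀ M, (∀ k, constantCoeff (Θ M k) = 0) ∧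
            (∀ i, B.r i ≠ 0 → Θ M (π i) = X i * e M i ∧ constantCoeff (e M i) ≠ 0) ∧
            IsUnit (Matrix.det (Matrix.of fun k m => coeff (Finsupp.single m 1) (Θ M k))) ∧
            ∃ U E : MvPolynomial (Fin 4) K, constantCoeff U ≠ 0 ∧ E ∈ originIdeal K ^ M ∧
              B.F = deletePthPowers p (U ^ p * aeval (Θ M) (c (k + 2 + t)).F) + E))
      ⟨1, hentry⟩
      (fun t B hB => by
        obtain ⟨π, hr, hpairB, hoB, -, hdivB, hisoB, heB, -, -⟩ := hB
        have hkt : k₀ ≤ k + 2 + t := by omega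
        obtain ⟨ho, hpo⟩ := hord (k + 2 + t) hkt
        refine ⟨hisoB, ?_, ?_, heB, hpairB, hdivB⟩
        · rw [hoB, ho, hr, Finsupp.degree_mapDomain]
        · rw [hr, Finsupp.degree_mapDomain]; exact hpo)
      (fun t B hB => by
        obtain ⟨π, hinv⟩ := hB
        have hkt : k₀ ≤ k + 2 + t := by omega
        have hkt1 : k₀ ≤ k + 2 + t + 1 := by omega
        obtain ⟨o, ho, hpo, ho2⟩ := chain_band p hc hfloor (k + 2 + t)
        obtain ⟨o', ho', hpo', ho2'⟩ := chain_band p hc hfloor (k + 2 + t + 1)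
        have hsh : (c (k + 2 + t + 1)).shade = (c (k + 2 + t)).shade := by rw [hshade _ hkt1, hshade _ hkt]
        obtain ⟨ℓ, β, π', hℓ, hβ, hinv'⟩ := SwapTransport.pair_virtual_step p hjj (c (k + 2 + t)) (c (k + 2 + t + 1)) B π
          (j (k + 2 + t)) (b (k + 2 + t)) (hw (k + 2 + t)).2.1 (hstep (k + 2 + t)) (hdivk _) (hdivk _) ⟨o, ho, hpo, ho2⟩
          ⟨o', ho', hpo', ho2'⟩ hsh (hc (k + 2 + t + 1)).1 (he _ hkt1) hinv
        exact ⟨ℓ, β, hℓ, hβ, π', hinv'⟩)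
  refine ⟨k + 2, a, a', c', j', b', by omega, hjj, h0, fun t => ?_, fun t => ?_, hc', hw', hr0', hfloor', hshade', he',
    hletters, hpass⟩
  · obtain ⟨π, hr, -⟩ := hInv t
    exact ⟨π, hr⟩
  · obtain ⟨π, -, -, -, -, -, -, -, hTTt, -⟩ := hInv t
    exact hTTt

end ResCone

end Summit.ResolutionOfSingularities.ResolutionOfSingularities.Theorems.PIDim4

end
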